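import Summits.QuantumFields.YangMills.Theses.ColdStartUniversality
import Summits.QuantumFields.YangMills.Theorems.ColdStartUniversalityUniformColdStartMixingIntegrand
import HarnessLib

/-!
# Route `ColdStartUniversality`, crux K_A1 `UniformColdStartMixing` (stmt-QuantumFields-24809):
# the shared node `stub_cesaroOfPointwise` — K-uniform POINTWISE mixing ⇒ K-uniform CESÀRO mixing

Helper file (seat `ym-line-csu-p1`; a `--supports 24809` node).  The planner's registered skeletons of the
crux (lines `birth`, `unitscale_coupling`, `cold_entropy` — shared block sha16 791e696b9d31a873) all end in
the same CESÀRO STEP `CesaroStep : PointwiseMixing → UniformColdStartMixing`: if, K-uniformly, every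
cold-start solution has `|expectAt K os − E[∏ avgObs (U(s/ε_K))]| ≤ η` at all physical times `s ≥ T_c`,
then the physical-time Cesàro means over `[0, T]` are `δ`-close to `expectAt K os` for ONE `T` (here
`T = T_c + 4 T_c/δ`, with `η = δ/2`) and all large `K`.

Proof: `T·expectAt − ∫₀ᵀ g = ∫₀ᵀ (expectAt − g)`; on `[0, T_c]` the integrand is bounded by `2`
(`|expectAt| ≤ 1`, `|g| ≤ 1`: tree `integrandRegular`, which also gives interval-integrability of `g` along
any cold-start solution), on `[T_c, T]` by `η`; divide by `T`.

`cesaroStep` is the registered statement with the skeleton's local abbreviations (`G2`, `su2Rep`, `avSU`,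
`toField`, `obsK`, `eqExpect`, `IsColdStartSol`) unfolded, so that `stub_cesaroOfPointwise := cesaroStep`
elaborates by `rfl`-unfolding.  No definition, no sorry.  RECORD-rung R3 plumbing; this proves nothing about
K_A1 itself (whose content is the hypothesis `PointwiseMixing`) or the mass gap.
-/

set_option autoImplicit false

noncomputable section

namespace Summit.QuantumFields.YangMills.Theorems.ColdStartUniversality

open MeasureTheory ProbabilityTheory intervalIntegral
open scoped NNReal
open Literature.MathematicalPhysics.QuantumFieldTheory
open Literature.MathematicalPhysics.QuantumLattice (fundamentalRep fundamentalLatticeRep continuous_fundamentalRep)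
open Literature.MathematicalPhysics.QuantumFieldTheory.Balaban1983to89

/-- **Cesàro bookkeeping** (real analysis): if `|e| ≤ 1`, `|g s| ≤ 1` for all `s`, `g` is interval-integrable on
`[0, T']` for every `T'`, and `|e − g s| ≤ η` for `s ≥ T_c > 0`, then for `T = T_c + 4 T_c/δ` and `η ≤ δ/2`,
`|e − T⁻¹ ∫₀ᵀ g| ≤ δ`. [folklore] -/
theorem abs_sub_inv_mul_integral_le {e : ℝ} {g : ℝ → ℝ} {Tc δ η : ℝ} (hTc : 0 < Tc) (hδ : 0 < δ)
    (hη : η ≤ δ / 2) (he : |e| ≤ 1) (hg : ∀ s, |g s| ≤ 1)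
    (hgi : ∀ T', IntervalIntegrable g volume 0 T') (hmix : ∀ s, Tc ≤ s → |e - g s| ≤ η) :
    |e - (Tc + 4 * Tc / δ)⁻¹ * ∫ s in (0 : ℝ)..(Tc + 4 * Tc / δ), g s| ≤ δ := by
  set T : ℝ := Tc + 4 * Tc / δ with hT
  have hT0 : 0 < T := by positivity
  have hTcT : Tc ≤ T := by rw [hT]; exact le_add_of_nonneg_right (by positivity)
  have hη0 : 0 ≤ η := (abs_nonneg _).trans (hmix Tc le_rfl)
  -- `g` and the constant `e` are interval-integrable on the two pieces
  have hgi' : ∀ a b : ℝ, IntervalIntegrable g volume a b := fun a b =>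
    ((hgi a).symm).trans (hgi b)
  have hci : ∀ a b : ℝ, IntervalIntegrable (fun s => e - g s) volume a b := fun a b =>
    (intervalIntegrable_const).sub (hgi' a b)
  -- rewrite the Cesàro defect as `T⁻¹ ∫₀ᵀ (e - g)`
  have hint : ∫ s in (0 : ℝ)..T, (e - g s) = T * e - ∫ s in (0 : ℝ)..T, g s := by
    rw [intervalIntegral.integral_sub intervalIntegrable_const (hgi' 0 T), intervalIntegral.integral_const,
      sub_zero, smul_eq_mul]
  have hkey : e - T⁻¹ * ∫ s in (0 : ℝ)..T, g s = T⁻¹ * ∫ s in (0 : ℝ)..T, (e - g s) := by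
    rw [hint, mul_sub, ← mul_assoc, inv_mul_cancel₀ hT0.ne', one_mul]
  rw [hkey, abs_mul, abs_inv, abs_of_pos hT0]
  -- split at `Tc`
  have hsplit : ∫ s in (0 : ℝ)..T, (e - g s) =
      (∫ s in (0 : ℝ)..Tc, (e - g s)) + ∫ s in Tc..T, (e - g s) :=
    (intervalIntegral.integral_add_adjacent_intervals (hci 0 Tc) (hci Tc T)).symm
  have h1 : |∫ s in (0 : ℝ)..Tc, (e - g s)| ≤ 2 * |Tc - 0| := by
    have := intervalIntegral.norm_integral_le_of_norm_le_const (a := 0) (b := Tc) (C := 2)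
      (f := fun s => e - g s) (fun s _ => by
        rw [Real.norm_eq_abs]
        calc |e - g s| ≤ |e| + |g s| := abs_sub _ _
          _ ≤ 1 + 1 := add_le_add he (hg s)
          _ = 2 := by norm_num)
    simpa [Real.norm_eq_abs] using this
  have h2 : |∫ s in Tc..T, (e - g s)| ≤ η * |T - Tc| := by
    have := intervalIntegral.norm_integral_le_of_norm_le_const (a := Tc) (b := T) (C := η)
      (f := fun s => e - g s) (fun s hs => by
        rw [Real.norm_eq_abs]
        have hs' : Tc < s := by
          rw [Set.uIoc_of_le hTcT] at hs
          exact hs.1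
        exact hmix s hs'.le)
    simpa [Real.norm_eq_abs] using this
  rw [sub_zero, abs_of_pos hTc] at h1
  rw [abs_of_nonneg (sub_nonneg.mpr hTcT)] at h2
  have h3 : |∫ s in (0 : ℝ)..T, (e - g s)| ≤ 2 * Tc + η * (T - Tc) := by
    rw [hsplit]
    exact (abs_add_le _ _).trans (add_le_add h1 h2)
  have h4 : 2 * Tc + η * (T - Tc) ≤ 2 * Tc + δ / 2 * T := by
    have : η * (T - Tc) ≤ δ / 2 * T := by
      calc η * (T - Tc) ≤ η * T := by gcongr; linarith
        _ ≤ δ / 2 * T := by gcongr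
    linarith
  have h5 : T⁻¹ * (2 * Tc + δ / 2 * T) ≤ δ := by
    rw [inv_mul_le_iff₀ hT0]
    -- `2 Tc ≤ (δ/2) T` since `T ≥ 4 Tc/δ`
    have hT4 : 4 * Tc / δ ≤ T := by rw [hT]; exact le_add_of_nonneg_left hTc.le
    have : 2 * Tc ≤ δ / 2 * T :=
      calc 2 * Tc = δ / 2 * (4 * Tc / δ) := by field_simp; ring
        _ ≤ δ / 2 * T := by gcongr
    linarith
  calc T⁻¹ * |∫ s in (0 : ℝ)..T, (e - g s)| ≤ T⁻¹ * (2 * Tc + η * (T - Tc)) := by gcongr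
    _ ≤ T⁻¹ * (2 * Tc + δ / 2 * T) := by gcongr
    _ ≤ δ := h5

/-- **`CesaroStep` (registered stub `stub_cesaroOfPointwise`, shared by the lines `birth` / `unitscale_coupling` /
`cold_entropy` of crux K_A1, stmt-QuantumFields-24809): K-uniform pointwise mixing of every loop string along
every cold-start solution implies the crux `UniformColdStartMixing`** (K-uniform Cesàro mixing in physical
time), with `T = T_c(δ/2) + 8 T_c(δ/2)/δ`.  The statement is the skeleton's `PointwiseMixing → UniformColdStartMixing`
with its local abbreviations unfolded. [folklore] -/
theorem cesaroStep :
    (∃ γ₁ : ℝ, 0 < γ₁ ∧ ∀ (F : T3ContinuumYM3Torus.T3Family) (γ : ℝ), 0 < γ → γ ≤ γ₁ →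
      ∀ (os : List (T3ContinuumYM3Torus.ULoop3 F)) (η : ℝ), 0 < η →
        ∃ Tc : ℝ, 0 < Tc ∧ ∃ K₀ : ℕ, ∀ K : ℕ, K₀ ≤ K →
          ∀ (Ω : Type) (mΩ : MeasurableSpace Ω) (P : Measure Ω) (_ : IsProbabilityMeasure P)
            (W : ℝ≥0 → Ω → (Edge 3 ((F.P K).sitesPerDir 0) × NoiseIdx 2 → ℝ)) (hW : IsFlatBrownian W P)
            (U : ℝ≥0 → Ω → GaugeConfig 3 ((F.P K).sitesPerDir 0) (Matrix.specialUnitaryGroup (Fin 2) ℂ)),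
            ((∀ ω, U 0 ω = fun _ => 1) ∧
              (latticeLangevinDynamics (⟨2, fundamentalRep (Fin 2), continuous_fundamentalRep _,
                  Literature.MathematicalPhysics.QuantumLattice.fundamentalRep_injective _,
                  Literature.MathematicalPhysics.QuantumLattice.fundamentalRep_mem_unitaryGroup⟩ :
                  LatticeRep (Matrix.specialUnitaryGroup (Fin 2) ℂ)) ((γ * (F.P K).eps)⁻¹ / 2)).IsSolution
                (fundamentalRep (Fin 2)) hW.natFiltration P W U) →
              ∀ s : ℝ, Tc ≤ s →
                |(F.scheme (ExpMeanLog.expMeanLogSU : LoopAverage (Matrix.specialUnitaryGroup (Fin 2) ℂ)) γ).expectAt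
                      K os -
                    ∫ ω, (os.map fun C => F.avgObs (ExpMeanLog.expMeanLogSU :
                        LoopAverage (Matrix.specialUnitaryGroup (Fin 2) ℂ)) K C
                      (fun b : PBond (F.P K) 0 => U (s / (F.P K).eps).toNNReal ω (b.src, b.dir))).prod ∂P| ≤ η) →
    Summit.QuantumFields.YangMills.Theses.ColdStartUniversality.UniformColdStartMixing := by
  rintro ⟨γ₁, hγ₁, hPM⟩
  refine ⟨γ₁, hγ₁, fun F γ hγ hγle os δ hδ => ?_⟩
  obtain ⟨Tc, hTc, K₀, hK₀⟩ := hPM F γ hγ hγle os (δ / 2) (by positivity)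
  refine ⟨Tc + 4 * Tc / δ, by positivity, K₀, fun K hK Ω mΩ P hP W hW U hU0 hsol => ?_⟩
  obtain ⟨he, hg, hgi⟩ := integrandRegular F γ hγ os K Ω mΩ P hP W hW U hU0 hsol
  exact abs_sub_inv_mul_integral_le hTc hδ le_rfl he hg hgi
    (fun s hs => hK₀ K hK Ω mΩ P hP W hW U ⟨hU0, hsol⟩ s hs)

end Summit.QuantumFields.YangMills.Theorems.ColdStartUniversality

end
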